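import Literature.Analysis.FluidPDE.SereginSverak2002VertexBlowupLimit
import Literature.Analysis.FluidPDE.SereginSverakTypeIConsequences
import Literature.Analysis.FluidPDE.ClassicalNSPairingIdentity
import Literature.Analysis.FluidPDE.ClassicalSolutionRescale
import HarnessLib

/-!
# One-sided pressure bounds: the time modulus of the zoomed pairings near the vertex

Analysis/FluidPDE proof file (theorems only; no definitions, no named facts) on the discharge
path of `Literature.Analysis.FluidPDE.seregin_sverak_2002` (Seregin–Šverák, ARMA 163 (2002), §4).
For a classical solution on `[0, T) × ℝ³` (`ν = 1`) which is Leray–Hopf on `[0, T]`, with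
`|u|²/2 + p̃ ≤ K` or `p̃ ≥ -K`, a centre `x₀` and a test field `φ ∈ C_c^∞(B(0, a))`, the pairings
of the zooms `u_R(s, y) = R u(T + R² s, x₀ + R y)` against `φ` have a **modulus of continuity at
the final time which is uniform in the scale**:

* `SereginSverak2002.zoom_pairing_modulus` —
  `|∫ ⟪u_R(s), φ⟫ - ∫ ⟪u_R(0), φ⟫| ≤ C (|s| + |s|^{1/3})` for `0 < R ≤ R₀`, `s ∈ (-1, 0)`.

Proof: the zoomed pair is again a classical solution (`nsRescale_translate_zero`), to which the
pairing identity with pressure (`IsClassicalNSSolutionOn.integral_inner_sub_eq_pressure`) is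
applied with the *fixed* field `φ`; the velocity terms are bounded through the uniform Morrey
bound of `SereginSverakTypeIConsequences` (`∫_{B(0,a)} |u_R|² ≤ M a`), the pressure term through
Hölder and the Type I bound on `D` at the vertex (`exists_vertex_cknC_cknD_le`), both scale
invariant; the endpoint is reached by the weak `L²` continuity of `u` at `T`.

## References

* G. Seregin, V. Šverák, Arch. Ration. Mech. Anal. 163 (2002), 65–86, §4. [SereginSverak2002]
-/

noncomputable section

open MeasureTheory TopologicalSpace Set Function Filter Topology Metric InnerProductSpace Real
open scoped ENNReal NNReal RealInnerProductSpace ContDiff Laplacian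

namespace Literature.Analysis.FluidPDE

namespace SereginSverak2002

/-! ### Slice bounds for pairings against a fixed test field -/

section Slice

variable {v : EuclideanSpace ℝ (Fin 3) → EuclideanSpace ℝ (Fin 3)}
  {φ : EuclideanSpace ℝ (Fin 3) → EuclideanSpace ℝ (Fin 3)} {a : ℝ}

/-- `|∫ ⟪v, (v·∇)φ⟫| ≤ C₁ ∫_{B(0,a)} |v|²` when `‖Dφ‖ ≤ C₁` and `φ` is supported in `B(0,a)`. [folklore] -/
theorem abs_integral_inner_convect_le
    (hv2 : IntegrableOn (fun y => ‖v y‖ ^ 2) (ball (0 : EuclideanSpace ℝ (Fin 3)) a))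
    (hφa : tsupport φ ⊆ ball (0 : EuclideanSpace ℝ (Fin 3)) a)
    {C₁ : ℝ} (hC₁ : ∀ y, ‖fderiv ℝ φ y‖ ≤ C₁) :
    |∫ y, ⟪v y, convect v φ y⟫| ≤ C₁ * ∫ y in ball (0 : EuclideanSpace ℝ (Fin 3)) a, ‖v y‖ ^ 2 := by
  have hC0 : 0 ≤ C₁ := (norm_nonneg _).trans (hC₁ 0)
  have hzero : ∀ y, y ∉ ball (0 : EuclideanSpace ℝ (Fin 3)) a → ⟪v y, convect v φ y⟫ = 0 := by
    intro y hy
    have : fderiv ℝ φ y = 0 := fderiv_of_notMem_tsupport (𝕜 := ℝ) fun h => hy (hφa h)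
    simp [convect, this]
  rw [← setIntegral_eq_integral_of_forall_compl_eq_zero hzero, ← integral_const_mul, ← Real.norm_eq_abs]
  refine norm_integral_le_of_norm_le (hv2.const_mul C₁) ?_
  filter_upwards with y
  rw [Real.norm_eq_abs, convect]
  calc |⟪v y, fderiv ℝ φ y (v y)⟫| ≤ ‖v y‖ * ‖fderiv ℝ φ y (v y)‖ := abs_real_inner_le_norm _ _
    _ ≤ ‖v y‖ * (C₁ * ‖v y‖) := by
        gcongr
        exact (ContinuousLinearMap.le_opNorm _ _).trans (mul_le_mul_of_nonneg_right (hC₁ y) (norm_nonneg _))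
    _ = C₁ * ‖v y‖ ^ 2 := by ring

/-- `|∫ ⟪v, Δφ⟫| ≤ C₂ (|B(0,a)| + ∫_{B(0,a)} |v|²)/2` when `‖Δφ‖ ≤ C₂`, `φ` supported in `B(0,a)`
(`|v| ≤ (1 + |v|²)/2`). [folklore] -/
theorem abs_integral_inner_laplacian_le
    (hv2 : IntegrableOn (fun y => ‖v y‖ ^ 2) (ball (0 : EuclideanSpace ℝ (Fin 3)) a))
    (hφa : tsupport φ ⊆ ball (0 : EuclideanSpace ℝ (Fin 3)) a)
    {C₂ : ℝ} (hC₂ : ∀ y, ‖(Δ φ) y‖ ≤ C₂) :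
    |∫ y, ⟪v y, (Δ φ) y⟫| ≤
      C₂ * ((volume.real (ball (0 : EuclideanSpace ℝ (Fin 3)) a) +
        ∫ y in ball (0 : EuclideanSpace ℝ (Fin 3)) a, ‖v y‖ ^ 2) / 2) := by
  have hC0 : 0 ≤ C₂ := (norm_nonneg _).trans (hC₂ 0)
  have hzero : ∀ y, y ∉ ball (0 : EuclideanSpace ℝ (Fin 3)) a → ⟪v y, (Δ φ) y⟫ = 0 := by
    intro y hy
    rw [laplacian_eq_zero_of_notMem_tsupport (fun h => hy (hφa h)), inner_zero_right]
  have hfin : volume (ball (0 : EuclideanSpace ℝ (Fin 3)) a) < ⊤ := measure_ball_lt_top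
  have hint : IntegrableOn (fun y => C₂ * ((1 + ‖v y‖ ^ 2) / 2)) (ball (0 : EuclideanSpace ℝ (Fin 3)) a) :=
    (((integrableOn_const (C := (1 : ℝ)) hfin.ne).add hv2).div_const 2).const_mul C₂
  rw [← setIntegral_eq_integral_of_forall_compl_eq_zero hzero, ← Real.norm_eq_abs]
  refine (norm_integral_le_of_norm_le hint ?_).trans (le_of_eq ?_)
  · filter_upwards with y
    rw [Real.norm_eq_abs]
    calc |⟪v y, (Δ φ) y⟫| ≤ ‖v y‖ * ‖(Δ φ) y‖ := abs_real_inner_le_norm _ _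
      _ ≤ ((1 + ‖v y‖ ^ 2) / 2) * C₂ :=
          mul_le_mul (by nlinarith [sq_nonneg (‖v y‖ - 1), norm_nonneg (v y)]) (hC₂ y) (norm_nonneg _)
            (by positivity)
      _ = C₂ * ((1 + ‖v y‖ ^ 2) / 2) := by ring
  · rw [integral_const_mul, integral_div, integral_add (integrableOn_const (C := (1 : ℝ)) hfin.ne) hv2,
      setIntegral_const, smul_eq_mul, mul_one]

/-- A constant gauge shift of the pressure does not change `∫ p div φ`. [folklore] -/
theorem integral_add_const_mul_divergence {q : EuclideanSpace ℝ (Fin 3) → ℝ} (c : ℝ)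
    (hφ : ContDiff ℝ 1 φ) (hφc : HasCompactSupport φ)
    (hq : Integrable fun y => q y * VectorCalculus.divergence φ y) :
    ∫ y, (q y + c) * VectorCalculus.divergence φ y = ∫ y, q y * VectorCalculus.divergence φ y := by
  have hdc : Continuous fun y => VectorCalculus.divergence φ y := continuous_divergence (hφ.continuous_fderiv one_ne_zero)
  have hds : HasCompactSupport fun y => VectorCalculus.divergence φ y := by
    refine hφc.fderiv (𝕜 := ℝ) |>.mono fun y hy => ?_
    contrapose! hy
    simp only [mem_support, not_not] at hy
    simp [VectorCalculus.divergence, hy]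
  have hdi : Integrable fun y => VectorCalculus.divergence φ y := hdc.integrable_of_hasCompactSupport hds
  simp_rw [add_mul]
  rw [integral_add hq (hdi.const_mul c), integral_const_mul, integral_divergence_eq_zero hφ hφc,
    mul_zero, add_zero]

end Slice

/-! ### The pressure of the zoom: a scale-invariant space–time `L¹` bound -/

section Pressure

variable {q : ℝ → EuclideanSpace ℝ (Fin 3) → ℝ} {T : ℝ} {x₀ : EuclideanSpace ℝ (Fin 3)}

/-- **Scale-invariant `L¹` bound for the zoomed pressure.** If `∫_{Q_{aR}(T,x₀)} |q|^{3/2} ≤ K₀ (aR)²`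
and `q` is a.e.-strongly measurable on the slab, then for `t = T + R² s`, `s ∈ (-1, 0)`, `1 ≤ a`, the
zoomed pressure `q_R(σ, y) = R² q(t + R² σ, x₀ + R y)` is integrable on `(0, |s|) × B(0, a)` with
`∫∫ |q_R| ≤ (K₀ a²)^{2/3} (|s| |B(0,a)|)^{1/3}`. [folklore] -/
theorem zoom_pressure_bound
    (hqm : AEStronglyMeasurable (uncurry q) (volume.restrict (Ioo 0 T ×ˢ (univ : Set (EuclideanSpace ℝ (Fin 3))))))
    {a R K₀ s : ℝ} (ha : 1 ≤ a) (hR : 0 < R) (hK₀ : 0 ≤ K₀) (hs : s ∈ Ioo (-1 : ℝ) 0)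
    (haRT : (a * R) ^ 2 < T)
    (hD : ∫⁻ z in parabolicCylinder (a * R) (T, x₀), ‖q z.1 z.2‖ₑ ^ (3 / 2 : ℝ) ≤
      ENNReal.ofReal (K₀ * (a * R) ^ 2)) :
    IntegrableOn (uncurry ((R ^ 2) • stPull (R ^ 2) R (T + R ^ 2 * s) x₀ q))
        (Ioo 0 |s| ×ˢ ball (0 : EuclideanSpace ℝ (Fin 3)) a) ∧
      ∫ z in Ioo 0 |s| ×ˢ ball (0 : EuclideanSpace ℝ (Fin 3)) a,
          |((R ^ 2) • stPull (R ^ 2) R (T + R ^ 2 * s) x₀ q) z.1 z.2| ≤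
        (K₀ * a ^ 2) ^ (2 / 3 : ℝ) * (|s| * volume.real (ball (0 : EuclideanSpace ℝ (Fin 3)) a)) ^ (1 / 3 : ℝ) := by
  have ha0 : 0 < a := by linarith
  have hs0 : 0 < |s| := abs_pos.2 hs.2.ne
  have hs1 : |s| < 1 := by rw [abs_of_neg hs.2]; linarith [hs.1]
  set t : ℝ := T + R ^ 2 * s with ht
  set Qv : Set (ℝ × EuclideanSpace ℝ (Fin 3)) := Ioo 0 |s| ×ˢ ball (0 : EuclideanSpace ℝ (Fin 3)) a with hQv
  set P : Set (ℝ × EuclideanSpace ℝ (Fin 3)) :=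
    stAffine (R ^ 2) R t x₀ ⁻¹' parabolicCylinder (a * R) (T, x₀) with hP
  -- `Qv ⊆ P = (|s| - a², |s|) × B(0, a)`
  have hPeq : P = Ioo (|s| - a ^ 2) |s| ×ˢ ball (0 : EuclideanSpace ℝ (Fin 3)) a := by
    simp only [hP, parabolicCylinder]
    rw [stAffine_preimage_cylinder (by positivity) hR]
    have e1 : ((T - (a * R) ^ 2 - t) / R ^ 2) = |s| - a ^ 2 := by
      rw [abs_of_neg hs.2, ht]; field_simp; ring
    have e2 : (T - t) / R ^ 2 = |s| := by rw [abs_of_neg hs.2, ht]; field_simp; ring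
    have e3 : R⁻¹ • (x₀ - x₀) = (0 : EuclideanSpace ℝ (Fin 3)) := by simp
    have e4 : a * R / R = a := by field_simp
    rw [e1, e2, e3, e4]
  have hQP : Qv ⊆ P := by
    rw [hPeq]
    exact prod_mono (Ioo_subset_Ioo (by nlinarith) le_rfl) subset_rfl
  have hQm : MeasurableSet Qv := measurableSet_Ioo.prod measurableSet_ball
  -- the cylinder at the vertex lies in the slab, so `q` is integrable on it
  have hcyl : parabolicCylinder (a * R) (T, x₀) ⊆ Ioo 0 T ×ˢ (univ : Set (EuclideanSpace ℝ (Fin 3))) := by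
    intro z hz
    rw [mem_parabolicCylinder] at hz
    exact ⟨⟨by linarith [hz.1.1], hz.1.2⟩, mem_univ _⟩
  have hqmc : AEStronglyMeasurable (uncurry q) (volume.restrict (parabolicCylinder (a * R) (T, x₀))) :=
    hqm.mono_measure (Measure.restrict_mono hcyl le_rfl)
  have hfin : volume (parabolicCylinder (a * R) (T, x₀)) < ⊤ := by
    rw [parabolicCylinder]
    exact ((isCompact_Icc.prod (isCompact_closedBall _ _)).measure_lt_top).trans_le'
      (measure_mono (prod_mono Ioo_subset_Icc_self ball_subset_closedBall))
  haveI : IsFiniteMeasure (volume.restrict (parabolicCylinder (a * R) (T, x₀))) :=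
    ⟨by rw [Measure.restrict_apply_univ]; exact hfin⟩
  have h32 : ((3 : ℝ≥0∞) / 2).toReal = (3 / 2 : ℝ) := by rw [ENNReal.toReal_div]; norm_num
  have hqmem : MemLp (uncurry q) (3 / 2) (volume.restrict (parabolicCylinder (a * R) (T, x₀))) := by
    refine ⟨hqmc, ?_⟩
    rw [eLpNorm_lt_top_iff_lintegral_rpow_enorm_lt_top (by norm_num) (by simp [ENNReal.div_eq_top]), h32]
    exact hD.trans_lt ENNReal.ofReal_lt_top
  have h1le : (1 : ℝ≥0∞) ≤ 3 / 2 := by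
    rw [← ENNReal.div_self two_ne_zero ENNReal.ofNat_ne_top]
    exact ENNReal.div_le_div_right (by norm_num) 2
  have hqint : IntegrableOn (uncurry q) (parabolicCylinder (a * R) (T, x₀)) := hqmem.integrable h1le
  -- transport to the zoom
  have hPint : IntegrableOn (uncurry (stPull (R ^ 2) R t x₀ q)) P := by
    rw [uncurry_stPull]
    exact (integrableOn_comp_stAffine_iff (by positivity) hR t x₀ _ _).2 hqint
  have hQint : IntegrableOn (uncurry ((R ^ 2) • stPull (R ^ 2) R t x₀ q)) Qv := by
    have : uncurry ((R ^ 2) • stPull (R ^ 2) R t x₀ q) = fun z => R ^ 2 * uncurry (stPull (R ^ 2) R t x₀ q) z := by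
      funext z; rfl
    rw [this]
    exact (hPint.mono_set hQP).const_mul _
  refine ⟨hQint, ?_⟩
  -- the `L^{3/2}` mass of the zoomed pressure on `P`
  have hlin : ∫⁻ z in Qv, ‖((R ^ 2) • stPull (R ^ 2) R t x₀ q) z.1 z.2‖ₑ ^ (3 / 2 : ℝ) ≤
      ENNReal.ofReal (K₀ * a ^ 2) := by
    refine (lintegral_mono_set hQP).trans ?_
    rw [hP, setLIntegral_enorm_rpow_stRescale (by positivity) hR t x₀ (R ^ 2) q _ (by norm_num),
      finrank_euclideanSpace_fin]
    have e1 : ‖(R ^ 2 : ℝ)‖ₑ ^ (3 / 2 : ℝ) = ENNReal.ofReal (R ^ 3) := by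
      rw [Real.enorm_eq_ofReal (by positivity), ENNReal.ofReal_rpow_of_nonneg (by positivity) (by norm_num)]
      congr 1
      rw [show (R ^ 2 : ℝ) = R ^ (2 : ℝ) by norm_cast, ← Real.rpow_mul hR.le]
      norm_num
    rw [e1]
    calc ENNReal.ofReal (R ^ 3) * ENNReal.ofReal (R ^ 2 * R ^ 3)⁻¹ *
          ∫⁻ z in parabolicCylinder (a * R) (T, x₀), ‖q z.1 z.2‖ₑ ^ (3 / 2 : ℝ)
        ≤ ENNReal.ofReal (R ^ 3) * ENNReal.ofReal (R ^ 2 * R ^ 3)⁻¹ * ENNReal.ofReal (K₀ * (a * R) ^ 2) := by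
          gcongr
      _ = ENNReal.ofReal (K₀ * a ^ 2) := by
          rw [← ENNReal.ofReal_mul (by positivity), ← ENNReal.ofReal_mul (by positivity)]
          congr 1
          field_simp
  -- Hölder `L¹ ≤ L^{3/2} |Qv|^{1/3}`
  set μ : Measure (ℝ × EuclideanSpace ℝ (Fin 3)) := volume.restrict Qv with hμ
  have hvolQ : volume Qv = ENNReal.ofReal (|s| * volume.real (ball (0 : EuclideanSpace ℝ (Fin 3)) a)) := by
    rw [hQv, Measure.volume_eq_prod, Measure.prod_prod, Real.volume_Ioo, sub_zero,
      ENNReal.ofReal_mul hs0.le]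
    congr 1
    rw [Measure.real, ENNReal.ofReal_toReal measure_ball_lt_top.ne]
  have hF : AEStronglyMeasurable (uncurry ((R ^ 2) • stPull (R ^ 2) R t x₀ q)) μ := hQint.aestronglyMeasurable
  have hH := eLpNorm_le_eLpNorm_mul_rpow_measure_univ (p := 1) (q := (3 / 2 : ℝ≥0∞)) (μ := μ) h1le hF
  rw [eLpNorm_one_eq_lintegral_enorm, eLpNorm_eq_lintegral_rpow_enorm_toReal (by norm_num)
    (by simp [ENNReal.div_eq_top]), h32, hμ, Measure.restrict_apply_univ] at hH
  simp only [ENNReal.toReal_one, div_one, one_div] at hH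
  have hexp : (1 - (3 / 2 : ℝ)⁻¹) = (1 / 3 : ℝ) := by norm_num
  rw [hexp] at hH
  -- the real integral as a lower integral
  have hreal : ∫ z in Qv, |((R ^ 2) • stPull (R ^ 2) R t x₀ q) z.1 z.2| =
      (∫⁻ z in Qv, ‖uncurry ((R ^ 2) • stPull (R ^ 2) R t x₀ q) z‖ₑ).toReal := by
    rw [← integral_norm_eq_lintegral_enorm hF]
    rfl
  rw [hreal]
  have hK : (∫⁻ z in Qv, ‖uncurry ((R ^ 2) • stPull (R ^ 2) R t x₀ q) z‖ₑ ^ (3 / 2 : ℝ)) ^ ((3 / 2 : ℝ)⁻¹) ≤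
      ENNReal.ofReal ((K₀ * a ^ 2) ^ (2 / 3 : ℝ)) := by
    rw [show ((3 / 2 : ℝ)⁻¹) = (2 / 3 : ℝ) by norm_num,
      ← ENNReal.ofReal_rpow_of_nonneg (by positivity) (by norm_num)]
    exact ENNReal.rpow_le_rpow hlin (by norm_num)
  have hV : volume Qv ^ (1 / 3 : ℝ) = ENNReal.ofReal ((|s| * volume.real (ball (0 : EuclideanSpace ℝ (Fin 3)) a)) ^ (1 / 3 : ℝ)) := by
    rw [hvolQ, ENNReal.ofReal_rpow_of_nonneg (by positivity) (by norm_num)]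
  refine ENNReal.toReal_le_of_le_ofReal (by positivity) (hH.trans ?_)
  rw [hV, ENNReal.ofReal_mul (by positivity)]
  gcongr

end Pressure

/-! ### The modulus -/

section Modulus

variable {T : ℝ} {u : ℝ → EuclideanSpace ℝ (Fin 3) → EuclideanSpace ℝ (Fin 3)}
  {p : ℝ → EuclideanSpace ℝ (Fin 3) → ℝ}

/-- **Morrey bound for the zoomed slices**: `∫_{B(0,a)} |R u(θ, x₀ + R y)|² dy ≤ M a` whenever
`∫_{B(x₀, aR)} |u(θ)|² ≤ M (aR)`. [folklore] -/
theorem setIntegral_ball_norm_sq_space_zoom_le {b : EuclideanSpace ℝ (Fin 3) → EuclideanSpace ℝ (Fin 3)}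
    (x₀ : EuclideanSpace ℝ (Fin 3)) {a R M : ℝ} (hR : 0 < R)
    (hM : ∫ x in ball x₀ (a * R), ‖b x‖ ^ 2 ≤ M * (a * R)) :
    ∫ y in ball (0 : EuclideanSpace ℝ (Fin 3)) a, ‖R • b (x₀ + R • y)‖ ^ 2 ≤ M * a := by
  have hiff : ∀ y : EuclideanSpace ℝ (Fin 3), x₀ + R • y ∈ ball x₀ (a * R) ↔
      y ∈ ball (0 : EuclideanSpace ℝ (Fin 3)) a := by
    intro y
    rw [mem_ball, mem_ball_zero_iff, dist_eq_norm, add_sub_cancel_left, norm_smul, Real.norm_eq_abs,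
      abs_of_pos hR, mul_comm]
    exact mul_lt_mul_iff_of_pos_right hR
  have e : ∫ y in ball (0 : EuclideanSpace ℝ (Fin 3)) a, ‖R • b (x₀ + R • y)‖ ^ 2 =
      R ^ 2 * ∫ y, (ball x₀ (a * R)).indicator (fun x => ‖b x‖ ^ 2) (x₀ + R • y) := by
    rw [← integral_indicator measurableSet_ball, ← integral_const_mul]
    refine integral_congr_ae (Eventually.of_forall fun y => ?_)
    show (ball (0 : EuclideanSpace ℝ (Fin 3)) a).indicator (fun y => ‖R • b (x₀ + R • y)‖ ^ 2) y =
      R ^ 2 * (ball x₀ (a * R)).indicator (fun x => ‖b x‖ ^ 2) (x₀ + R • y)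
    by_cases hy : y ∈ ball (0 : EuclideanSpace ℝ (Fin 3)) a
    · rw [indicator_of_mem hy, indicator_of_mem ((hiff y).2 hy), norm_smul, Real.norm_eq_abs, abs_of_pos hR]
      ring
    · rw [indicator_of_notMem hy, indicator_of_notMem (fun h => hy ((hiff y).1 h)), mul_zero]
  rw [e, integral_comp_space_affine hR x₀, finrank_euclideanSpace_fin, integral_indicator measurableSet_ball,
    smul_eq_mul]
  calc R ^ 2 * ((R ^ 3)⁻¹ * ∫ x in ball x₀ (a * R), ‖b x‖ ^ 2) = R⁻¹ * ∫ x in ball x₀ (a * R), ‖b x‖ ^ 2 := by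
        field_simp
    _ ≤ R⁻¹ * (M * (a * R)) := mul_le_mul_of_nonneg_left hM (inv_nonneg.2 hR.le)
    _ = M * a := by field_simp

/-- The pairing of a zoomed slice is the pairing of the slice with a rescaled field:
`∫ ⟪R b(x₀ + R y), φ(y)⟫ dy = ∫ ⟪b(x), R R⁻³ φ(R⁻¹(x - x₀))⟫ dx`. [folklore] -/
theorem integral_inner_space_zoom (b φ : EuclideanSpace ℝ (Fin 3) → EuclideanSpace ℝ (Fin 3))
    (x₀ : EuclideanSpace ℝ (Fin 3)) {R : ℝ} (hR : 0 < R) :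
    ∫ y, ⟪R • b (x₀ + R • y), φ y⟫ = ∫ x, ⟪b x, (R * (R ^ 3)⁻¹) • φ (R⁻¹ • (x - x₀))⟫ := by
  have h := integral_comp_space_affine hR x₀ (fun x => ⟪b x, φ (R⁻¹ • (x - x₀))⟫)
  rw [finrank_euclideanSpace_fin] at h
  have e1 : ∀ y, ⟪R • b (x₀ + R • y), φ y⟫ = R * ⟪b (x₀ + R • y), φ (R⁻¹ • (x₀ + R • y - x₀))⟫ := by
    intro y
    rw [real_inner_smul_left, add_sub_cancel_left, smul_smul, inv_mul_cancel₀ hR.ne', one_smul]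
  simp_rw [e1]
  rw [integral_const_mul, h, smul_eq_mul, ← mul_assoc, ← integral_const_mul]
  refine integral_congr_ae (Eventually.of_forall fun x => ?_)
  show R * (R ^ 3)⁻¹ * ⟪b x, φ (R⁻¹ • (x - x₀))⟫ = ⟪b x, (R * (R ^ 3)⁻¹) • φ (R⁻¹ • (x - x₀))⟫
  rw [real_inner_smul_right]

set_option maxHeartbeats 800000 in
/-- **The slice bound for the zoomed pairing identity**: at a zoomed time `τ` with
`t + R²τ ∈ (0, T)` and `aR ≤ 1/2`, the velocity terms are bounded by the Morrey constant and the
pressure term by `C₃ ∫_{B(0,a)} |q_R(τ)|` (gauged pressure). [folklore] -/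
theorem zoom_slice_pairing_bound (hsol : IsClassicalNSSolutionOn (Ico 0 T) 1 0 u p)
    (hLH : IsLerayHopfOn T 1 0 (u 0) u) {K : ℝ} (hK : 0 ≤ K)
    (hone : (∀ t ∈ Ioo 0 T, ∀ x, ‖u t x‖ ^ 2 / 2 + normalisedPressure (u t) x ≤ K) ∨
      (∀ t ∈ Ioo 0 T, ∀ x, -K ≤ normalisedPressure (u t) x))
    (x₀ : EuclideanSpace ℝ (Fin 3)) {φ : EuclideanSpace ℝ (Fin 3) → EuclideanSpace ℝ (Fin 3)} {a : ℝ}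
    (hφ1 : ContDiff ℝ 1 φ) (hφc : HasCompactSupport φ)
    (hφa : tsupport φ ⊆ ball (0 : EuclideanSpace ℝ (Fin 3)) a)
    {C₁ C₂ C₃ : ℝ} (hC₁ : ∀ y, ‖fderiv ℝ φ y‖ ≤ C₁) (hC₂ : ∀ y, ‖(Δ φ) y‖ ≤ C₂)
    (hC₃ : ∀ y, ‖VectorCalculus.divergence φ y‖ ≤ C₃)
    {R t τ : ℝ} (hR : 0 < R) (haR0 : 0 < a * R) (haRhalf : a * R ≤ 1 / 2) (hθ : t + R ^ 2 * τ ∈ Ioo 0 T) :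
    ‖((∫ y, (⟪(R • stPull (R ^ 2) R t x₀ u) τ y, convect ((R • stPull (R ^ 2) R t x₀ u) τ) φ y⟫ +
          1 * ⟪(R • stPull (R ^ 2) R t x₀ u) τ y, (Δ φ) y⟫ +
          ⟪(0 : ℝ → EuclideanSpace ℝ (Fin 3) → EuclideanSpace ℝ (Fin 3)) τ y, φ y⟫)) +
        ∫ y, ((R ^ 2) • stPull (R ^ 2) R t x₀ p) τ y * VectorCalculus.divergence φ y)‖ ≤
      (C₁ * (2 * ((∫ x, ‖u 0 x‖ ^ 2) + 4 * π * K) * a) +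
          C₂ * ((volume.real (ball (0 : EuclideanSpace ℝ (Fin 3)) a) +
            2 * ((∫ x, ‖u 0 x‖ ^ 2) + 4 * π * K) * a) / 2)) +
        C₃ * ∫ y in ball (0 : EuclideanSpace ℝ (Fin 3)) a,
          |((R ^ 2) • stPull (R ^ 2) R t x₀ (fun t x => p t x - (p t 0 - normalisedPressure (u t) 0))) τ y| := by
  have hC₁0 : 0 ≤ C₁ := (norm_nonneg _).trans (hC₁ 0)
  have hC₂0 : 0 ≤ C₂ := (norm_nonneg _).trans (hC₂ 0)
  have hC₃0 : 0 ≤ C₃ := (norm_nonneg _).trans (hC₃ 0)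
  have hθI : t + R ^ 2 * τ ∈ Ico 0 T := ⟨hθ.1.le, hθ.2⟩
  set MA : ℝ := 2 * ((∫ x, ‖u 0 x‖ ^ 2) + 4 * π * K) with hMA
  set θ : ℝ := t + R ^ 2 * τ with hθdef
  set vτ : EuclideanSpace ℝ (Fin 3) → EuclideanSpace ℝ (Fin 3) := (R • stPull (R ^ 2) R t x₀ u) τ with hvτ
  set qτ : EuclideanSpace ℝ (Fin 3) → ℝ :=
    ((R ^ 2) • stPull (R ^ 2) R t x₀ (fun t x => p t x - (p t 0 - normalisedPressure (u t) 0))) τ with hqτ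
  have hv_apply : ∀ y, vτ y = R • u θ (x₀ + R • y) := fun y => rfl
  have hq_apply : ∀ y, qτ y = R ^ 2 * (p θ (x₀ + R • y) - (p θ 0 - normalisedPressure (u θ) 0)) := fun y => rfl
  have hp_apply : ∀ y, ((R ^ 2) • stPull (R ^ 2) R t x₀ p) τ y = R ^ 2 * p θ (x₀ + R • y) := fun y => rfl
  -- the slice `vτ`: continuity and local energy
  have hu : Continuous (u θ) := (hsol.contDiff_velocity hθI).continuous
  have hvc : Continuous vτ := by
    have : vτ = fun y => R • u θ (x₀ + R • y) := funext hv_apply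
    rw [this]; fun_prop
  have hv2 : IntegrableOn (fun y => ‖vτ y‖ ^ 2) (ball (0 : EuclideanSpace ℝ (Fin 3)) a) :=
    ((hvc.norm.pow 2).continuousOn.integrableOn_compact (isCompact_closedBall 0 a)).mono_set ball_subset_closedBall
  have hMor : ∫ y in ball (0 : EuclideanSpace ℝ (Fin 3)) a, ‖vτ y‖ ^ 2 ≤ MA * a := by
    have h1 := setIntegral_ball_norm_sq_le_uniform zero_le_one hsol hLH hK hone hθ x₀ haR0 haRhalf
    have : (fun y => ‖vτ y‖ ^ 2) = fun y => ‖R • u θ (x₀ + R • y)‖ ^ 2 := funext fun y => by rw [hv_apply]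
    rw [this]
    exact setIntegral_ball_norm_sq_space_zoom_le x₀ hR h1
  -- the velocity terms
  have hfin : volume (ball (0 : EuclideanSpace ℝ (Fin 3)) a) < ⊤ := measure_ball_lt_top
  have i1 : IntegrableOn (fun _ : EuclideanSpace ℝ (Fin 3) => (1 : ℝ)) (ball (0 : EuclideanSpace ℝ (Fin 3)) a) :=
    integrableOn_const (C := (1 : ℝ)) hfin.ne
  have iA : IntegrableOn (fun y => (1 + ‖vτ y‖ ^ 2) / 2) (ball (0 : EuclideanSpace ℝ (Fin 3)) a) :=
    (i1.add hv2).div_const 2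
  have hH1 : ‖∫ y, (⟪vτ y, convect vτ φ y⟫ + 1 * ⟪vτ y, (Δ φ) y⟫ +
      ⟪(0 : ℝ → EuclideanSpace ℝ (Fin 3) → EuclideanSpace ℝ (Fin 3)) τ y, φ y⟫)‖ ≤
      C₁ * (MA * a) + C₂ * ((volume.real (ball (0 : EuclideanSpace ℝ (Fin 3)) a) + MA * a) / 2) := by
    have hzero : ∀ y, y ∉ ball (0 : EuclideanSpace ℝ (Fin 3)) a →
        ⟪vτ y, convect vτ φ y⟫ + 1 * ⟪vτ y, (Δ φ) y⟫ +
          ⟪(0 : ℝ → EuclideanSpace ℝ (Fin 3) → EuclideanSpace ℝ (Fin 3)) τ y, φ y⟫ = 0 := by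
      intro y hy
      have h1 : fderiv ℝ φ y = 0 := fderiv_of_notMem_tsupport (𝕜 := ℝ) fun h => hy (hφa h)
      have h2 : (Δ φ) y = 0 := laplacian_eq_zero_of_notMem_tsupport fun h => hy (hφa h)
      simp [convect, h1, h2]
    rw [← setIntegral_eq_integral_of_forall_compl_eq_zero hzero]
    have iB : IntegrableOn (fun y => C₁ * ‖vτ y‖ ^ 2 + C₂ * ((1 + ‖vτ y‖ ^ 2) / 2))
        (ball (0 : EuclideanSpace ℝ (Fin 3)) a) := (hv2.const_mul C₁).add (iA.const_mul C₂)
    refine (norm_integral_le_of_norm_le iB ?_).trans ?_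
    · filter_upwards with y
      rw [Real.norm_eq_abs]
      simp only [Pi.zero_apply, inner_zero_left, add_zero, one_mul]
      have b1 : |⟪vτ y, convect vτ φ y⟫| ≤ C₁ * ‖vτ y‖ ^ 2 := by
        rw [convect]
        calc |⟪vτ y, fderiv ℝ φ y (vτ y)⟫| ≤ ‖vτ y‖ * ‖fderiv ℝ φ y (vτ y)‖ := abs_real_inner_le_norm _ _
          _ ≤ ‖vτ y‖ * (C₁ * ‖vτ y‖) := by
              gcongr
              exact (ContinuousLinearMap.le_opNorm _ _).trans (mul_le_mul_of_nonneg_right (hC₁ y) (norm_nonneg _))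
          _ = C₁ * ‖vτ y‖ ^ 2 := by ring
      have b2 : |⟪vτ y, (Δ φ) y⟫| ≤ C₂ * ((1 + ‖vτ y‖ ^ 2) / 2) := by
        calc |⟪vτ y, (Δ φ) y⟫| ≤ ‖vτ y‖ * ‖(Δ φ) y‖ := abs_real_inner_le_norm _ _
          _ ≤ ((1 + ‖vτ y‖ ^ 2) / 2) * C₂ :=
              mul_le_mul (by nlinarith [sq_nonneg (‖vτ y‖ - 1), norm_nonneg (vτ y)]) (hC₂ y) (norm_nonneg _)
                (by positivity)
          _ = C₂ * ((1 + ‖vτ y‖ ^ 2) / 2) := by ring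
      exact (abs_add_le _ _).trans (add_le_add b1 b2)
    · rw [integral_add (hv2.const_mul C₁) (iA.const_mul C₂), integral_const_mul, integral_const_mul,
        integral_div, integral_add i1 hv2, setIntegral_const, smul_eq_mul, mul_one]
      gcongr
  -- the pressure term, through the gauged pressure
  have hdc : Continuous fun y => VectorCalculus.divergence φ y := continuous_divergence (hφ1.continuous_fderiv one_ne_zero)
  have hds : HasCompactSupport fun y => VectorCalculus.divergence φ y := by
    refine (hφc.fderiv (𝕜 := ℝ)).mono fun y hy => ?_
    contrapose! hy
    simp only [mem_support, not_not] at hy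
    simp [VectorCalculus.divergence, hy]
  have hp' : Continuous (p θ) := (hsol.contDiff_pressure hθI).continuous
  have hqc : Continuous qτ := by
    have : qτ = fun y => R ^ 2 * (p θ (x₀ + R • y) - (p θ 0 - normalisedPressure (u θ) 0)) := funext hq_apply
    rw [this]; fun_prop
  have hqdi : Integrable fun y => qτ y * VectorCalculus.divergence φ y :=
    (hqc.mul hdc).integrable_of_hasCompactSupport hds.mul_left
  have hgauge : ∫ y, ((R ^ 2) • stPull (R ^ 2) R t x₀ p) τ y * VectorCalculus.divergence φ y =
      ∫ y, qτ y * VectorCalculus.divergence φ y := by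
    have e : ∀ y, ((R ^ 2) • stPull (R ^ 2) R t x₀ p) τ y =
        qτ y + R ^ 2 * (p θ 0 - normalisedPressure (u θ) 0) := by
      intro y; rw [hp_apply, hq_apply]; ring
    simp_rw [e]
    exact integral_add_const_mul_divergence _ hφ1 hφc hqdi
  have hH2 : ‖∫ y, ((R ^ 2) • stPull (R ^ 2) R t x₀ p) τ y * VectorCalculus.divergence φ y‖ ≤
      C₃ * ∫ y in ball (0 : EuclideanSpace ℝ (Fin 3)) a, |qτ y| := by
    rw [hgauge]
    have hzero : ∀ y, y ∉ ball (0 : EuclideanSpace ℝ (Fin 3)) a → qτ y * VectorCalculus.divergence φ y = 0 := by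
      intro y hy
      have : VectorCalculus.divergence φ y = 0 := by
        simp [VectorCalculus.divergence, fderiv_of_notMem_tsupport (𝕜 := ℝ) fun h => hy (hφa h)]
      rw [this, mul_zero]
    rw [← setIntegral_eq_integral_of_forall_compl_eq_zero hzero]
    have hint : IntegrableOn (fun y => C₃ * |qτ y|) (ball (0 : EuclideanSpace ℝ (Fin 3)) a) :=
      ((hqc.abs.continuousOn.integrableOn_compact (isCompact_closedBall 0 a)).mono_set ball_subset_closedBall).const_mul C₃
    refine (norm_integral_le_of_norm_le hint ?_).trans (le_of_eq ?_)
    · filter_upwards with y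
      rw [Real.norm_eq_abs, abs_mul, mul_comm]
      exact mul_le_mul ((le_of_eq (Real.norm_eq_abs _).symm).trans (hC₃ y)) le_rfl (abs_nonneg _) hC₃0
    · rw [integral_const_mul]
  exact (norm_add_le _ _).trans (add_le_add hH1 hH2)

set_option maxHeartbeats 3200000 in
/-- **The uniform time modulus of the zoomed pairings** (see the module docstring).
[cite: SereginSverak2002, §4] -/
theorem zoom_pairing_modulus (hT : 0 < T)
    (hsol : IsClassicalNSSolutionOn (Ico 0 T) 1 0 u p) (hLH : IsLerayHopfOn T 1 0 (u 0) u)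
    {K : ℝ} (hK : 0 ≤ K)
    (hone : (∀ t ∈ Ioo 0 T, ∀ x, ‖u t x‖ ^ 2 / 2 + normalisedPressure (u t) x ≤ K) ∨
      (∀ t ∈ Ioo 0 T, ∀ x, -K ≤ normalisedPressure (u t) x))
    (x₀ : EuclideanSpace ℝ (Fin 3)) {φ : EuclideanSpace ℝ (Fin 3) → EuclideanSpace ℝ (Fin 3)}
    (hφ : ContDiff ℝ ∞ φ) (hφc : HasCompactSupport φ) {a : ℝ} (ha : 1 ≤ a)
    (hφa : tsupport φ ⊆ ball (0 : EuclideanSpace ℝ (Fin 3)) a) :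
    ∃ C : ℝ, 0 ≤ C ∧ ∃ R₀ > 0, ∀ R, 0 < R → R ≤ R₀ → ∀ s ∈ Ioo (-1 : ℝ) 0,
      |(∫ y, ⟪R • u (T + R ^ 2 * s) (x₀ + R • y), φ y⟫) - ∫ y, ⟪R • u T (x₀ + R • y), φ y⟫| ≤
        C * (|s| + |s| ^ (1 / 3 : ℝ)) := by
  have ha0 : 0 < a := by linarith
  -- the Morrey constant
  set E0 : ℝ := ∫ x, ‖u 0 x‖ ^ 2 with hE0
  have hE00 : 0 ≤ E0 := integral_nonneg fun x => sq_nonneg _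
  set MA : ℝ := 2 * (E0 + 4 * π * K) with hMA
  have hMA0 : 0 ≤ MA := by positivity
  -- the pressure constant at the vertex
  set ρ₁ : ℝ := min (1 / 2) (Real.sqrt T / 2) with hρ₁
  have hρ₁pos : 0 < ρ₁ := lt_min (by norm_num) (by positivity)
  have hρ₁half : ρ₁ ≤ 1 / 2 := min_le_left _ _
  have hρ₁T : ρ₁ ^ 2 < T := by
    have h1 : ρ₁ ≤ Real.sqrt T / 2 := min_le_right _ _
    have h2 : (Real.sqrt T) ^ 2 = T := Real.sq_sqrt hT.le
    nlinarith [Real.sqrt_nonneg T, Real.sqrt_pos.2 hT]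
  obtain ⟨K₀, hK₀⟩ := exists_vertex_cknC_cknD_le hT hsol hLH hK hone x₀ hρ₁pos hρ₁half hρ₁T
  set q : ℝ → EuclideanSpace ℝ (Fin 3) → ℝ := fun t x => p t x - (p t 0 - normalisedPressure (u t) 0) with hq
  have hqm := aestronglyMeasurable_gauge_slab hT hsol hLH
  -- bounds of the test field
  have hφ1 : ContDiff ℝ 1 φ := contDiff_infty.1 hφ 1
  have hφ2 : ContDiff ℝ 2 φ := contDiff_infty.1 hφ 2
  obtain ⟨C₁, hC₁⟩ := (hφ.continuous_fderiv (by simp)).bounded_above_of_compact_support (hφc.fderiv ℝ)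
  have hΔc : Continuous (Δ φ) := continuous_laplacian hφ2
  have hΔs : HasCompactSupport (Δ φ) :=
    hφc.mono' fun x hx => by contrapose! hx; simp [laplacian_eq_zero_of_notMem_tsupport hx]
  obtain ⟨C₂, hC₂⟩ := hΔc.bounded_above_of_compact_support hΔs
  have hdc : Continuous fun y => VectorCalculus.divergence φ y := continuous_divergence (hφ1.continuous_fderiv one_ne_zero)
  have hds : HasCompactSupport fun y => VectorCalculus.divergence φ y := by
    refine (hφc.fderiv (𝕜 := ℝ)).mono fun y hy => ?_
    contrapose! hy
    simp only [mem_support, not_not] at hy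
    simp [VectorCalculus.divergence, hy]
  obtain ⟨C₃, hC₃⟩ := hdc.bounded_above_of_compact_support hds
  have hC₁0 : 0 ≤ C₁ := (norm_nonneg _).trans (hC₁ 0)
  have hC₂0 : 0 ≤ C₂ := (norm_nonneg _).trans (hC₂ 0)
  have hC₃0 : 0 ≤ C₃ := (norm_nonneg _).trans (hC₃ 0)
  set VB : ℝ := volume.real (ball (0 : EuclideanSpace ℝ (Fin 3)) a) with hVB
  have hVB0 : 0 ≤ VB := measureReal_nonneg
  set CH : ℝ := C₁ * (MA * a) + C₂ * ((VB + MA * a) / 2) with hCH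
  have hCH0 : 0 ≤ CH := by positivity
  set CP : ℝ := C₃ * ((K₀ * a ^ 2) ^ (2 / 3 : ℝ) * VB ^ (1 / 3 : ℝ)) with hCP
  have hCP0 : 0 ≤ CP := by positivity
  refine ⟨CH + CP, by positivity, ρ₁ / (2 * a), by positivity, ?_⟩
  intro R hR hRR₀ s hs
  -- basic inequalities on the scales
  have haR : a * R ≤ ρ₁ / 2 := by
    calc a * R ≤ a * (ρ₁ / (2 * a)) := mul_le_mul_of_nonneg_left hRR₀ ha0.le
      _ = ρ₁ / 2 := by field_simp
  have haR0 : 0 < a * R := by positivity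
  have haRhalf : a * R ≤ 1 / 2 := by linarith
  have haRT : (a * R) ^ 2 < T := by nlinarith
  have hRaR : R ≤ a * R := le_mul_of_one_le_left hR.le ha
  have hR2T : R ^ 2 < T := lt_of_le_of_lt (pow_le_pow_left₀ hR.le hRaR 2) haRT
  have hR2 : 0 < R ^ 2 := pow_pos hR 2
  have hs0 : 0 < |s| := abs_pos.2 hs.2.ne
  have hsabs : |s| = -s := abs_of_neg hs.2
  have hs1 : |s| < 1 := by rw [hsabs]; linarith [hs.1]
  set t : ℝ := T + R ^ 2 * s with ht
  have ht0 : 0 < t := by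
    have h1 : R ^ 2 * (-1) < R ^ 2 * s := mul_lt_mul_of_pos_left hs.1 hR2
    simp only [ht]; linarith
  have htT : t < T := by
    have h1 : R ^ 2 * s < 0 := mul_neg_of_pos_of_neg hR2 hs.2
    simp only [ht]; linarith
  have htop : t + R ^ 2 * |s| = T := by rw [ht, hsabs]; ring
  have htime : ∀ σ ∈ Icc 0 |s|, t + R ^ 2 * σ ∈ Icc 0 T := by
    intro σ hσ
    have h1 : 0 ≤ R ^ 2 * σ := mul_nonneg hR2.le hσ.1
    have h2 : R ^ 2 * σ ≤ R ^ 2 * |s| := mul_le_mul_of_nonneg_left hσ.2 hR2.le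
    exact ⟨by linarith, by linarith⟩
  have htime' : ∀ σ ∈ Ioo 0 |s|, t + R ^ 2 * σ ∈ Ioo 0 T := by
    intro σ hσ
    have h1 : 0 < R ^ 2 * σ := mul_pos hR2 hσ.1
    have h2 : R ^ 2 * σ < R ^ 2 * |s| := mul_lt_mul_of_pos_left hσ.2 hR2
    exact ⟨by linarith, by linarith⟩
  -- the zoomed classical solution
  have hz := hsol.nsRescale_translate_zero hR t x₀
  set v : ℝ → EuclideanSpace ℝ (Fin 3) → EuclideanSpace ℝ (Fin 3) := R • stPull (R ^ 2) R t x₀ u with hv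
  set pv : ℝ → EuclideanSpace ℝ (Fin 3) → ℝ := (R ^ 2) • stPull (R ^ 2) R t x₀ p with hpv
  set qv : ℝ → EuclideanSpace ℝ (Fin 3) → ℝ := (R ^ 2) • stPull (R ^ 2) R t x₀ q with hqv
  have hv_apply : ∀ σ y, v σ y = R • u (t + R ^ 2 * σ) (x₀ + R • y) := fun σ y => rfl
  -- the pairing function
  set g : ℝ → ℝ := fun σ => ∫ y, ⟪v σ y, φ y⟫ with hg
  have hg0 : g 0 = ∫ y, ⟪R • u (T + R ^ 2 * s) (x₀ + R • y), φ y⟫ := by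
    simp only [hg, hv_apply, mul_zero, add_zero, ht]
  have hgs : g |s| = ∫ y, ⟪R • u T (x₀ + R • y), φ y⟫ := by
    simp only [hg, hv_apply, htop]
  -- the zoomed pressure: integrability and the `L¹` bound
  obtain ⟨hQint, hQbound⟩ := zoom_pressure_bound (q := q) (x₀ := x₀) hqm ha hR K₀.coe_nonneg hs haRT (by
    have h := (hK₀ (a * R) ⟨haR0, haR⟩).2
    simp only [cknD] at h
    rw [ENNReal.inv_mul_le_iff (by positivity) (ENNReal.pow_ne_top ENNReal.ofReal_ne_top)] at h
    refine h.trans (le_of_eq ?_)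
    rw [← ENNReal.ofReal_pow haR0.le, mul_comm, ENNReal.ofReal_mul K₀.coe_nonneg, ENNReal.ofReal_coe_nnreal])
  set Pf : ℝ → ℝ := fun τ => ∫ y in ball (0 : EuclideanSpace ℝ (Fin 3)) a, |qv τ y| with hPf
  have hPfint : IntegrableOn Pf (Ioo 0 |s|) := by
    have h1 : Integrable (uncurry qv) ((volume.restrict (Ioo 0 |s|)).prod
        (volume.restrict (ball (0 : EuclideanSpace ℝ (Fin 3)) a))) := by
      rw [Measure.prod_restrict, ← Measure.volume_eq_prod]; exact hQint
    have h2 := h1.integral_norm_prod_left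
    refine h2.congr (Eventually.of_forall fun τ => ?_)
    simp only [hPf, uncurry, Real.norm_eq_abs]
  have hPfnn : ∀ τ, 0 ≤ Pf τ := fun τ => integral_nonneg fun y => abs_nonneg _
  have hPftot : ∫ τ in Ioo 0 |s|, Pf τ ≤ (K₀ * a ^ 2) ^ (2 / 3 : ℝ) * (|s| * VB) ^ (1 / 3 : ℝ) := by
    have e : ∫ τ in Ioo 0 |s|, Pf τ = ∫ z in Ioo 0 |s| ×ˢ ball (0 : EuclideanSpace ℝ (Fin 3)) a, |qv z.1 z.2| := by
      rw [Measure.volume_eq_prod, setIntegral_prod (fun z : ℝ × EuclideanSpace ℝ (Fin 3) => |qv z.1 z.2|) (by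
        rw [← Measure.volume_eq_prod]
        exact hQint.norm.congr (Eventually.of_forall fun z => by
          show ‖uncurry qv z‖ = |qv z.1 z.2|
          rw [Real.norm_eq_abs]; rfl))]
    rw [e]
    exact hQbound
  -- Step A: the bound up to every `σ₂ < |s|`
  have hstepA : ∀ σ₂ ∈ Ioo 0 |s|, |g σ₂ - g 0| ≤ (CH + CP) * (|s| + |s| ^ (1 / 3 : ℝ)) := by
    intro σ₂ hσ₂
    have hσ₂0 : 0 < σ₂ := hσ₂.1
    -- the zoomed solution on `[0, σ₂]`
    have hsub : Icc 0 σ₂ ⊆ (fun r => t + R ^ 2 * r) ⁻¹' Ico 0 T := by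
      intro r hr
      have h := htime r ⟨hr.1, hr.2.trans hσ₂.2.le⟩
      have h2 : R ^ 2 * r < R ^ 2 * |s| := mul_lt_mul_of_pos_left (hr.2.trans_lt hσ₂.2) hR2
      exact ⟨h.1, by show t + R ^ 2 * r < T; linarith⟩
    have hloc := hz.mono hsub (uniqueDiffOn_Icc hσ₂0)
    have hid := hloc.integral_inner_sub_eq_pressure hσ₂0 hφ2 hφc le_rfl hσ₂0.le le_rfl
    -- the integrand of the time integral and its bound
    have hbound : ∀ τ ∈ Ioc 0 σ₂,
        ‖((∫ y, (⟪v τ y, convect (v τ) φ y⟫ + 1 * ⟪v τ y, (Δ φ) y⟫ +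
            ⟪(0 : ℝ → EuclideanSpace ℝ (Fin 3) → EuclideanSpace ℝ (Fin 3)) τ y, φ y⟫)) +
          ∫ y, pv τ y * VectorCalculus.divergence φ y)‖ ≤ CH + C₃ * Pf τ := by
      intro τ hτ
      have hθ : t + R ^ 2 * τ ∈ Ioo 0 T := htime' τ ⟨hτ.1, hτ.2.trans_lt hσ₂.2⟩
      exact zoom_slice_pairing_bound hsol hLH hK hone x₀ hφ1 hφc hφa hC₁ hC₂ hC₃ hR haR0 haRhalf hθ
    -- integrate the bound in time
    have hPfI : IntervalIntegrable (fun τ => CH + C₃ * Pf τ) volume 0 σ₂ := by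
      refine (intervalIntegrable_const.add ?_)
      rw [intervalIntegrable_iff_integrableOn_Ioo_of_le hσ₂0.le]
      exact (hPfint.mono_set (Ioo_subset_Ioo le_rfl hσ₂.2.le)).const_mul C₃
    have hnorm := intervalIntegral.norm_integral_le_of_norm_le hσ₂0.le
      (Eventually.of_forall fun τ hτ => hbound τ hτ) hPfI
    rw [← hid] at hnorm
    have hrhs : ∫ τ in (0 : ℝ)..σ₂, (CH + C₃ * Pf τ) ≤ CH * |s| + C₃ * ((K₀ * a ^ 2) ^ (2 / 3 : ℝ) * (|s| * VB) ^ (1 / 3 : ℝ)) := by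
      rw [intervalIntegral.integral_of_le hσ₂0.le, integral_Ioc_eq_integral_Ioo,
        integral_add (integrableOn_const (C := CH) measure_Ioo_lt_top.ne)
          ((hPfint.mono_set (Ioo_subset_Ioo le_rfl hσ₂.2.le)).const_mul C₃),
        setIntegral_const, integral_const_mul, Real.volume_real_Ioo_of_le hσ₂0.le, sub_zero, smul_eq_mul]
      have h1 : ∫ τ in Ioo 0 σ₂, Pf τ ≤ ∫ τ in Ioo 0 |s|, Pf τ :=
        setIntegral_mono_set hPfint (Eventually.of_forall hPfnn) (Eventually.of_forall (Ioo_subset_Ioo le_rfl hσ₂.2.le))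
      nlinarith [h1, hPftot, hσ₂.2, mul_comm σ₂ CH]
    have hsplit : (|s| * VB) ^ (1 / 3 : ℝ) = |s| ^ (1 / 3 : ℝ) * VB ^ (1 / 3 : ℝ) :=
      Real.mul_rpow hs0.le hVB0
    rw [Real.norm_eq_abs] at hnorm
    calc |g σ₂ - g 0| ≤ CH * |s| + C₃ * ((K₀ * a ^ 2) ^ (2 / 3 : ℝ) * (|s| * VB) ^ (1 / 3 : ℝ)) := hnorm.trans hrhs
      _ = CH * |s| + CP * |s| ^ (1 / 3 : ℝ) := by rw [hsplit]; simp only [hCP]; ring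
      _ ≤ (CH + CP) * (|s| + |s| ^ (1 / 3 : ℝ)) := by
          have : 0 ≤ |s| ^ (1 / 3 : ℝ) := by positivity
          nlinarith [hCH0, hCP0, hs0.le, this]
  -- Step B: let `σ₂ → |s|⁻` through the weak continuity of `u` at `T`
  set Φ : EuclideanSpace ℝ (Fin 3) → EuclideanSpace ℝ (Fin 3) := fun x => (R * (R ^ 3)⁻¹) • φ (R⁻¹ • (x - x₀))
    with hΦ
  have hφcont : Continuous φ := hφ.continuous
  have hΦc : Continuous Φ := by simp only [hΦ]; fun_prop
  have hΦs : HasCompactSupport Φ := by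
    set e : EuclideanSpace ℝ (Fin 3) ≃ₜ EuclideanSpace ℝ (Fin 3) :=
      (Homeomorph.addRight (-x₀)).trans (Homeomorph.smulOfNeZero R⁻¹ (inv_ne_zero hR.ne')) with he
    have h1 : (fun x => φ (R⁻¹ • (x - x₀))) = φ ∘ e := by
      funext x
      simp [he, Homeomorph.trans, sub_eq_add_neg]
    have h2 : HasCompactSupport fun x => φ (R⁻¹ • (x - x₀)) := by rw [h1]; exact hφc.comp_homeomorph e
    have h3 : Φ = (fun _ : EuclideanSpace ℝ (Fin 3) => R * (R ^ 3)⁻¹) • fun x => φ (R⁻¹ • (x - x₀)) := rfl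
    rw [h3]
    exact h2.smul_left
  have hΦmem : MemLp Φ 2 volume := hΦc.memLp_of_hasCompactSupport hΦs
  have hwcont : ContinuousOn (fun θ => ∫ x, ⟪u θ x, Φ x⟫) (Ioc 0 T) := (hLH.weak_continuous Φ hΦmem).1
  have hgeq : g = (fun θ => ∫ x, ⟪u θ x, Φ x⟫) ∘ fun σ => t + R ^ 2 * σ := by
    funext σ
    simp only [hg, Function.comp, hv_apply]
    exact integral_inner_space_zoom (u (t + R ^ 2 * σ)) φ x₀ hR
  have hgcont : ContinuousWithinAt g (Icc 0 |s|) |s| := by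
    rw [hgeq]
    refine ContinuousWithinAt.comp (t := Ioc 0 T) ?_ (by fun_prop) fun σ hσ => ?_
    · rw [htop]; exact hwcont T ⟨hT, le_rfl⟩
    · have h := htime σ hσ
      have h1 : 0 ≤ R ^ 2 * σ := mul_nonneg hR2.le hσ.1
      exact ⟨by show 0 < t + R ^ 2 * σ; linarith, h.2⟩
  have htend : Tendsto g (𝓝[<] |s|) (𝓝 (g |s|)) := by
    have h1 : Tendsto g (𝓝[Icc 0 |s|] |s|) (𝓝 (g |s|)) := hgcont
    rw [nhdsWithin_Icc_eq_nhdsLE hs0] at h1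
    exact h1.mono_left (nhdsWithin_mono _ Iio_subset_Iic_self)
  have hev : ∀ᶠ σ₂ in 𝓝[<] |s|, |g σ₂ - g 0| ≤ (CH + CP) * (|s| + |s| ^ (1 / 3 : ℝ)) := by
    filter_upwards [Ioo_mem_nhdsLT hs0] with σ₂ hσ₂ using hstepA σ₂ hσ₂
  have hlim := le_of_tendsto ((htend.sub_const (g 0)).abs) hev
  rw [← hg0, ← hgs, abs_sub_comm]
  exact hlim

end Modulus



end SereginSverak2002

end Literature.Analysis.FluidPDE

end
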